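import Literature.Algebra.Semigroups.FullTransformationGreen

/-!
# Generating systems of the full transformation semigroup `𝒯ₙ`

Source: O. Ganyushkin, V. Mazorchuk, *Classical Finite Transformation Semigroups*, Algebra and
Applications 9, Springer (2009) [GanyushkinMazorchuk2009], §3.1 "Generating systems in `𝒯ₙ`,
`𝒫𝒯ₙ`, and `ℐ𝒮ₙ`": Lemma 3.1.1 (i), Lemma 3.1.2 and Theorem 3.1.3 with its proof (the
two steps "all elements of rank `n - 1`" and "induction on the defect"), for `S = 𝒯ₙ`.

We regard `𝒯(X)`, `X` finite with `n` elements, as the monoid `Function.End X` (= `X → X`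
with `f * g = f ∘ g`, Mathlib), so that "generated by `A`" is `Submonoid.closure A`; the rank of
`α` is `(Set.range α).ncard` and `𝒮ₙ` is the set of bijective self-maps.

* Lemma 3.1.1 (i): a generating system of `𝒯ₙ` contains a generating system of `𝒮ₙ`: its
  bijective members generate all permutations (`closure_inter_bijective_of_closure_eq_top`);
* Lemma 3.1.2: a generating system of `𝒯ₙ` (`n ≥ 2`) contains an element of rank `n - 1`
  (`exists_mem_rank_pred_of_closure_eq_top`);
* proof of Theorem 3.1.3, step 1: if `rank α = n - 1` then every `β` of rank `n - 1` is
  `τ α π` with `τ, π ∈ 𝒮ₙ` (`exists_perm_comp_perm_of_rank_pred`), using the description of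
  the kernel of a rank-`(n-1)` map (`ker_of_rank_pred`);
* proof of Theorem 3.1.3, step 2 and conclusion: `𝒮ₙ` together with any one element `α` of
  rank `n - 1` generates `𝒯ₙ` (`closure_bijective_insert_eq_top`); the induction step writes a
  map `γ` of defect `k ≥ 2` as `γ = δμ` with `def δ = k - 1` and `μ` an idempotent of defect `1`
  (`exists_eq_comp_idempotent_of_defect`).

The "irreducible" bookkeeping of Theorem 3.1.3 (irreducible generating systems of `𝒯ₙ` are
exactly `A₁ ∪ {α}` with `A₁` irreducible for `𝒮ₙ`) is the conjunction of these statements and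
is not spelled out separately; `𝒫𝒯ₙ`, `ℐ𝒮ₙ` (Theorems 3.1.4, 3.1.5) are not treated.
-/

namespace Literature.Algebra.Semigroups.FullTransformation

open Function Set

variable {X : Type*}

/-! ### Ranks of products with permutations -/

/-- A self-map of a finite set of rank `n` is a permutation (rank `n` means surjective, and
surjective self-maps of a finite set are bijective, Proposition 1.1.3).
[cite: GanyushkinMazorchuk2009, Proposition 1.1.3] -/
theorem bijective_of_ncard_range_eq [Finite X] {α : X → X} (h : (range α).ncard = Nat.card X) :
    Bijective α := by
  have hsurj : Surjective α := by
    rw [← range_eq_univ, ← ncard_univ] at *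
    exact eq_of_subset_of_ncard_le (subset_univ _) h.ge
  exact ⟨Finite.injective_iff_surjective.2 hsurj, hsurj⟩

/-- A permutation has rank `n`. [cite: GanyushkinMazorchuk2009, Proposition 1.1.3] -/
theorem ncard_range_of_bijective [Finite X] {α : X → X} (h : Bijective α) :
    (range α).ncard = Nat.card X := by
  rw [h.2.range_eq, ncard_univ]

/-- Left multiplication by a permutation does not change the rank.
[cite: GanyushkinMazorchuk2009, Exercise 2.1.4 (c)] -/
theorem ncard_range_comp_of_injective [Finite X] {τ : X → X} (hτ : Injective τ) (α : X → X) :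
    (range (τ ∘ α)).ncard = (range α).ncard := by
  rw [range_comp, ncard_image_of_injective _ hτ]

/-- Right multiplication by a permutation does not change the rank.
[cite: GanyushkinMazorchuk2009, Exercise 2.1.4 (c)] -/
theorem ncard_range_comp_of_surjective {π : X → X} (hπ : Surjective π) (α : X → X) :
    (range (α ∘ π)).ncard = (range α).ncard := by
  rw [hπ.range_comp]

/-! ### Lemma 3.1.1 (i) and Lemma 3.1.2 -/

/-- **Lemma 3.1.1 (i)** (case `𝒯ₙ`): every generating system `A` of `𝒯ₙ` contains a generating
system of `𝒮ₙ` — an element of rank `n` is a product of elements of rank `n` only, so the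
permutations in `A` already generate every permutation.
[cite: GanyushkinMazorchuk2009, Lemma 3.1.1 (i)] -/
theorem closure_inter_bijective_of_closure_eq_top [Finite X] {A : Set (Function.End X)}
    (hA : Submonoid.closure A = ⊤) {σ : Function.End X} (hσ : Bijective σ) :
    σ ∈ Submonoid.closure (A ∩ {τ : Function.End X | Bijective τ}) := by
  have hmem : σ ∈ Submonoid.closure A := hA ▸ Submonoid.mem_top σ
  revert hσ
  refine Submonoid.closure_induction (motive := fun (x : Function.End X) _ => Bijective x →
      x ∈ Submonoid.closure (A ∩ {τ : Function.End X | Bijective τ})) ?_ ?_ ?_ hmem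
  · intro x hx hbx
    exact Submonoid.subset_closure ⟨hx, hbx⟩
  · intro _
    exact Submonoid.one_mem _
  · intro x y _ _ ihx ihy hxy
    -- `x ∘ y` bijective on a finite set forces `x` and `y` bijective
    have hy : Bijective y :=
      Finite.injective_iff_bijective.1 (Injective.of_comp (f := x) hxy.1)
    have hx : Bijective x :=
      Finite.surjective_iff_bijective.1 (Surjective.of_comp (g := y) hxy.2)
    exact Submonoid.mul_mem _ (ihx hx) (ihy hy)

/-- An idempotent of defect `1`: for `b₁ ≠ b₂` the map `μ = [b₂ ↦ b₁]` (identity elsewhere)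
has image `X \ {b₂}`. [cite: GanyushkinMazorchuk2009, Theorem 3.1.3] -/
theorem range_update_id [DecidableEq X] {b₁ b₂ : X} (hb : b₁ ≠ b₂) :
    range (update id b₂ b₁) = {b₂}ᶜ := by
  ext y
  simp only [mem_range, mem_compl_iff, mem_singleton_iff]
  constructor
  · rintro ⟨x, rfl⟩
    by_cases hx : x = b₂
    · subst hx; simp [hb]
    · simp [hx]
  · intro hy
    exact ⟨y, by simp [hy]⟩

/-- The idempotent `μ = [b₂ ↦ b₁]`, `b₁ ≠ b₂`, has rank `n - 1`.
[cite: GanyushkinMazorchuk2009, Theorem 3.1.3] -/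
theorem ncard_range_update_id [Finite X] [DecidableEq X] {b₁ b₂ : X} (hb : b₁ ≠ b₂) :
    (range (update id b₂ b₁)).ncard + 1 = Nat.card X := by
  rw [range_update_id hb, ncard_compl, ncard_singleton, Nat.sub_add_cancel]
  rw [← ncard_univ]
  exact (ncard_pos (toFinite _)).2 ⟨b₂, mem_univ _⟩

/-- **Lemma 3.1.2** (case `𝒯ₙ`, `n ≥ 2`): every generating system of `𝒯ₙ` contains an element
of rank `n - 1`: products of elements of rank `n` or `≤ n - 2` never have rank `n - 1`.
[cite: GanyushkinMazorchuk2009, Lemma 3.1.2] -/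
theorem exists_mem_rank_pred_of_closure_eq_top [Finite X] [Nontrivial X]
    {A : Set (Function.End X)} (hA : Submonoid.closure A = ⊤) :
    ∃ a ∈ A, (range a).ncard + 1 = Nat.card X := by
  classical
  by_contra hne
  push Not at hne
  -- every element of `⟨A⟩` has rank `≠ n - 1`
  have key : ∀ x ∈ Submonoid.closure A, (range x).ncard + 1 ≠ Nat.card X := by
    intro x hx
    refine Submonoid.closure_induction
      (motive := fun (x : Function.End X) _ => (range x).ncard + 1 ≠ Nat.card X)
      (fun x hx => hne x hx) ?_ ?_ hx
    · show (range (id : X → X)).ncard + 1 ≠ Nat.card X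
      rw [range_id, ncard_univ]; exact (Nat.lt_succ_self _).ne'
    · intro x y _ _ ihx ihy hxy
      -- `rank (xy) = n - 1 ≤ rank x ≤ n` and `rank x ≠ n - 1` force `rank x = n`
      have hxle : (range x).ncard ≤ Nat.card X := ncard_le_card _
      have hxge : (range ((x : X → X) ∘ y)).ncard ≤ (range x).ncard :=
        ncard_range_comp_le_left x y
      have hxy' : (range ((x : X → X) ∘ y)).ncard + 1 = Nat.card X := hxy
      have hxn : (range x).ncard = Nat.card X := by omega
      have hbx : Bijective (x : X → X) := bijective_of_ncard_range_eq hxn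
      rw [ncard_range_comp_of_injective hbx.1] at hxy'
      exact ihy hxy'
  obtain ⟨b₁, b₂, hb⟩ := exists_pair_ne X
  let μ : Function.End X := update id b₂ b₁
  have hμ : μ ∈ Submonoid.closure A := hA ▸ Submonoid.mem_top μ
  exact key μ hμ (ncard_range_update_id hb)

/-! ### Theorem 3.1.3, step 1: all elements of rank `n - 1` -/

/-- The image of a map omitting one point: if `β k = β l` with `k ≠ l` then
`im β = β(X \ {l})`. [cite: GanyushkinMazorchuk2009, Theorem 3.1.3] -/
theorem range_eq_image_compl_singleton {β : X → X} {k l : X} (hkl : k ≠ l) (hβ : β k = β l) :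
    range β = β '' {l}ᶜ := by
  refine Subset.antisymm ?_ (image_subset_range _ _)
  rintro _ ⟨x, rfl⟩
  by_cases hx : x = l
  · subst hx
    exact ⟨k, hkl, hβ⟩
  · exact ⟨x, hx, rfl⟩

/-- The kernel of a map of rank `n - 1` (used in the proof of Theorem 3.1.3): there is exactly
one pair `k ≠ l` with `β(k) = β(l)`, and `β(x) = β(y)` iff `x = y` or `{x, y} = {k, l}`.
[cite: GanyushkinMazorchuk2009, Theorem 3.1.3] -/
theorem ker_of_rank_pred [Finite X] {β : X → X} (hβ : (range β).ncard + 1 = Nat.card X) :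
    ∃ k l : X, k ≠ l ∧ β k = β l ∧
      ∀ x y, β x = β y ↔ x = y ∨ (x = k ∧ y = l) ∨ (x = l ∧ y = k) := by
  classical
  -- `β` is not injective
  have hni : ¬ Injective β := by
    intro hi
    have := ncard_range_of_bijective (Finite.injective_iff_bijective.1 hi)
    omega
  obtain ⟨k, l, hβkl, hkl⟩ : ∃ k l, β k = β l ∧ k ≠ l := by
    simpa [Injective, not_forall] using hni
  -- `β` is injective off `l`, and off `k`
  have hinj : ∀ {k l : X}, k ≠ l → β k = β l → InjOn β {l}ᶜ := by
    intro k l hkl hβkl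
    refine injOn_of_ncard_image_eq ?_ (toFinite _)
    rw [← range_eq_image_compl_singleton hkl hβkl, ncard_compl, ncard_singleton]
    omega
  have hl := hinj hkl hβkl
  have hk := hinj hkl.symm hβkl.symm
  refine ⟨k, l, hkl, hβkl, fun x y => ⟨fun h => ?_, ?_⟩⟩
  · by_cases hxy : x = y
    · exact Or.inl hxy
    · right
      -- one of `x, y` is `l` (injectivity off `l`) and one is `k` (injectivity off `k`)
      have h1 : x = l ∨ y = l := by
        by_contra hc
        push Not at hc
        exact hxy (hl hc.1 hc.2 h)
      have h2 : x = k ∨ y = k := by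
        by_contra hc
        push Not at hc
        exact hxy (hk hc.1 hc.2 h)
      rcases h1 with rfl | rfl
      · rcases h2 with h2 | rfl
        · exact absurd h2.symm hkl
        · exact Or.inr ⟨rfl, rfl⟩
      · rcases h2 with rfl | h2
        · exact Or.inl ⟨rfl, rfl⟩
        · exact absurd h2.symm hkl
  · rintro (rfl | ⟨rfl, rfl⟩ | ⟨rfl, rfl⟩)
    · rfl
    · exact hβkl
    · exact hβkl.symm

/-- **Theorem 3.1.3, step 1** (case `𝒯ₙ`): if `rank α = n - 1` then every `β` of rank `n - 1`
has the form `β = ταπ` with permutations `τ, π` — choose `π` with `π(k) = i`, `π(l) = j`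
where `{k, l}`, `{i, j}` are the collapsed pairs of `β`, `α`; then `απ` and `β` have the same
kernel, and `τ` exists by Proposition 4.5.3. [cite: GanyushkinMazorchuk2009, Theorem 3.1.3] -/
theorem exists_perm_comp_perm_of_rank_pred [Finite X] {α β : X → X}
    (hα : (range α).ncard + 1 = Nat.card X) (hβ : (range β).ncard + 1 = Nat.card X) :
    ∃ τ π : Equiv.Perm X, β = τ ∘ α ∘ π := by
  obtain ⟨i, j, hij, -, hkα⟩ := ker_of_rank_pred hα
  obtain ⟨k, l, hkl, -, hkβ⟩ := ker_of_rank_pred hβ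
  -- a permutation with `π k = i`, `π l = j`
  obtain ⟨π, hπ⟩ := Equiv.Perm.exists_extending_pair (fun b : Bool => if b then k else l)
    (fun b : Bool => if b then i else j)
    (fun b b' h => by cases b <;> cases b' <;> simp_all [hkl.symm])
    (fun b b' h => by cases b <;> cases b' <;> simp_all [hij.symm])
  have hπk : π k = i := by simpa using hπ true
  have hπl : π l = j := by simpa using hπ false
  -- `απ` and `β` have the same kernel partition
  have hker : ∀ x y, β x = β y ↔ (α ∘ π) x = (α ∘ π) y := by
    intro x y
    rw [hkβ, comp_apply, comp_apply, hkα, π.injective.eq_iff, ← hπk, ← hπl,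
      π.injective.eq_iff, π.injective.eq_iff, π.injective.eq_iff, π.injective.eq_iff]
  obtain ⟨τ, hτ⟩ := (greenL_iff_exists_perm β (α ∘ π)).1 ((greenL_iff β (α ∘ π)).2 hker)
  exact ⟨τ, π, hτ⟩

/-! ### Theorem 3.1.3, step 2: induction on the defect -/

/-- **Theorem 3.1.3, induction step** (case `𝒯ₙ`): a map `γ` of defect at least `2` factors as
`γ = δμ` where `δ` has rank `rank γ + 1` and `μ = [b₂ ↦ b₁]` is an idempotent of defect `1`
(`b₁ ≠ b₂` with `γ(b₁) = γ(b₂)`, `δ` = `γ` redefined at `b₂` to a point `a' ∉ im γ`).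
[cite: GanyushkinMazorchuk2009, Theorem 3.1.3] -/
theorem exists_eq_comp_idempotent_of_defect [Finite X] [DecidableEq X] {γ : X → X}
    (hγ : (range γ).ncard + 2 ≤ Nat.card X) :
    ∃ (δ : X → X) (b₁ b₂ : X), b₁ ≠ b₂ ∧ (range δ).ncard = (range γ).ncard + 1 ∧
      γ = δ ∘ update id b₂ b₁ := by
  -- `γ` is not injective and not surjective
  have hni : ¬ Injective γ := by
    intro hi
    have := ncard_range_of_bijective (Finite.injective_iff_bijective.1 hi)
    omega
  obtain ⟨b₁, b₂, hγb, hb⟩ : ∃ b₁ b₂, γ b₁ = γ b₂ ∧ b₁ ≠ b₂ := by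
    simpa [Injective, not_forall] using hni
  have hns : ∃ a', a' ∉ range γ := by
    by_contra hc
    push Not at hc
    have : range γ = univ := eq_univ_of_forall hc
    rw [this, ncard_univ] at hγ
    omega
  obtain ⟨a', ha'⟩ := hns
  refine ⟨update γ b₂ a', b₁, b₂, hb, ?_, ?_⟩
  · have hr : range (update γ b₂ a') = insert a' (range γ) := by
      ext y
      simp only [mem_range, mem_insert_iff]
      constructor
      · rintro ⟨x, rfl⟩
        by_cases hx : x = b₂
        · subst hx; simp
        · right; exact ⟨x, by simp [hx]⟩
      · rintro (rfl | ⟨x, rfl⟩)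
        · exact ⟨b₂, by simp⟩
        · by_cases hx : x = b₂
          · subst hx
            exact ⟨b₁, by rw [update_of_ne hb, hγb]⟩
          · exact ⟨x, by simp [hx]⟩
    rw [hr, ncard_insert_of_notMem ha']
  · funext x
    simp only [comp_apply]
    by_cases hx : x = b₂
    · subst hx
      rw [update_self, update_of_ne hb, hγb]
    · rw [update_of_ne hx, id, update_of_ne hx]

/-- **Theorem 3.1.3** (case `𝒯ₙ`, the generating part): the symmetric group `𝒮ₙ` together with
any single transformation `α` of rank `n - 1` generates the full transformation semigroup
`𝒯ₙ` — hence `A₁ ∪ {α}` generates `𝒯ₙ` for every generating system `A₁` of `𝒮ₙ`.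
[cite: GanyushkinMazorchuk2009, Theorem 3.1.3] -/
theorem closure_bijective_insert_eq_top [Finite X] {α : Function.End X}
    (hα : (range α).ncard + 1 = Nat.card X) :
    Submonoid.closure (insert α {σ : Function.End X | Bijective σ}) = ⊤ := by
  classical
  set S := Submonoid.closure (insert α {σ : Function.End X | Bijective σ})
  have hS : ∀ σ : Function.End X, Bijective σ → σ ∈ S := fun σ hσ =>
    Submonoid.subset_closure (Or.inr hσ)
  have hαS : α ∈ S := Submonoid.subset_closure (Or.inl rfl)
  -- step 1: all maps of rank `n - 1`
  have h1 : ∀ β : Function.End X, (range β).ncard + 1 = Nat.card X → β ∈ S := by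
    intro β hβ
    obtain ⟨τ, π, hβ'⟩ := exists_perm_comp_perm_of_rank_pred hα hβ
    let τ' : Function.End X := ⇑τ
    let π' : Function.End X := ⇑π
    have : β = τ' * (α * π') := hβ'
    rw [this]
    exact Submonoid.mul_mem _ (hS τ' τ.bijective) (Submonoid.mul_mem _ hαS (hS π' π.bijective))
  -- step 2: induction on the defect `d ≥ 1`
  have h2 : ∀ d : ℕ, 1 ≤ d → ∀ γ : Function.End X, (range γ).ncard + d = Nat.card X →
      γ ∈ S := by
    intro d hd
    induction d, hd using Nat.le_induction with
    | base => exact h1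
    | succ d hd ih =>
      intro γ hγ
      obtain ⟨δ, b₁, b₂, hb, hδ, hγδ⟩ :=
        exists_eq_comp_idempotent_of_defect (γ := γ) (by omega)
      let μ : Function.End X := update id b₂ b₁
      let δ' : Function.End X := δ
      have hμ : μ ∈ S := h1 μ (ncard_range_update_id hb)
      have : γ = δ' * μ := hγδ
      rw [this]
      exact Submonoid.mul_mem _ (ih δ' (by simpa [δ'] using (by omega : (range δ).ncard + d = Nat.card X))) hμ
  -- conclusion
  refine (Submonoid.eq_top_iff' S).2 fun γ => ?_
  by_cases hγ : Bijective γ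
  · exact hS γ hγ
  · have hlt : (range γ).ncard < Nat.card X :=
      lt_of_le_of_ne (ncard_le_card _) fun h => hγ (bijective_of_ncard_range_eq h)
    exact h2 (Nat.card X - (range γ).ncard) (by omega) γ (by omega)

end Literature.Algebra.Semigroups.FullTransformation
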